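import Summits.Ventures.Crystal3D.Theorems.StickyWulffConstantTextureLiminfTexShadowCoverableSplitDefs
import Summits.Ventures.Crystal3D.Theorems.StickyWulffConstantGenericWallFloorBarlowOrientedGlue
import Summits.Ventures.Crystal3D.Theorems.StickyWulffConstantGenericWallFloorBarlowReversal
import Summits.Ventures.Crystal3D.Theorems.StickyWulffConstantTextureLiminfLineCountGlue
import HarnessLib

/-!
# The walker-covered wall stub BY NAME, modulo E1 and StarPairFar: `BilayerWallWalkerCoveredFrom 6` from lane G's F4
# (lane T, crux `TextureLiminf`, stmt-Ventures-19483; registered line `TexShadow` v6.9/v6.10, stub `stub_bilayerWallWalkerCovered`)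

HONEST FRAMING. Venture `Summits/Ventures/Crystal3D` (cell `crystal3d-full`), helper `--supports` the crux
`TextureLiminf` (stmt-Ventures-19483) of `route-Ventures-StickyWulffConstant`, registered line `TexShadow` (cf-p1
ROUTE.md §86(77) BT DECISION (xxxvii), §86(87) CD).  Rung credit only; F-C1 not moved.  NOT the wall law: the WALKER-COVERED
part of the generic two-plate wall law only (`BilayerWallWalkerCovered`, `…TexShadowCoverableSplitDefs`), and CONDITIONAL on
lane G's two named computational inputs — E1 (`ExactOnly 0 {w ∈ fccSlots | 0 < ⟪w, sE⟫}`, the kernel of `P5Exhaustion`) and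
StarPairFar's consequences `DoubleStarCoaxialAt` / `CapPairCoaxial` — carried as hypotheses (so the theorem is a
`conditional-result` in the audit's sense; the on-reach, deficient and residual parts of the wall law are other stubs).

CHAIN.  `stub_bilayerWallWalkerCovered : ∃ R, 1 ≤ R ∧ BilayerWallWalkerCoveredFrom R` asks for the cell inequality
`BilayerWallAt C R₀ σ₁ σ₂ L₁ L₂ s₁ s₂ c` for every generic, BARLOW-COVERABLE pair of plates (`DeltaSteep L₁ e₃ ∧ DeltaSteep L₂ (−e₃)
∧ BarlowOffReach`, pinned to the family slots) and every admissible, FLUX-DOMINATED (`√2/2`) table.  Per pair: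
(1) coverability gives EXACTLY the hypothesis list of lane G's oriented F4 glue `barlow_hlines_oriented` (19480-p2 p653507) for the
UP-PRESENTATIONS `(upFrame Lᵢ zᵢ, upWord Lᵢ σᵢ zᵢ)` — `upFrame_axis_nonneg`, `famSlot_steep_of_deltaSteep`, `BarlowOffReach`
verbatim (its `stacking L₂ s₂ σ₂` re-keyed by `stacking_upFrame`); (2) F4 returns the machine's step selectors of the
up-presentations and, cell by cell, the window-line count `#T₁ + #T₂ + 18mρ ≤ Σ_PAY(12 − deg) + (318 + 192R₀)(1+h)ρ`;
(3) `selector_of_upFrame` transports each selector to the ORIGINAL presentation with the same moved window points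
(`isZigSelector_reverse`, `moved_vertex_reverse` of 19480-p2's `…BarlowReversal`, p653669), the cell keys by `stacking_upFrame`;
(4) `bilayerWallAt_of_lineCount` (wulff-p2 g13 p648386: `cell_charge_le_lines_margin_sel` + `bilayerWallAt_of_payerBound`) turns the
count into the cell inequality.

* `selector_of_upFrame` — oriented selector ↦ original selector, same window points;
* `bilayerWallWalkerCoveredFrom_of_orientedLineCounts` — CoveredGlue v2: `R ≥ 3` and oriented line counts (the exact shape of
  `barlow_hlines_oriented`, one rim constant `C_w` per `R₀`) ⇒ `BilayerWallWalkerCoveredFrom R` (rim constant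
  `(C_w + 80(R₀+9) + 3456 + 1152(R₀+1))/2`; the frames, the residual-class exclusion and the axes of the covered part are idle);
* **`bilayerWallWalkerCovered_of_F4`** — E1 + (hDS, hCP) ⇒ `∃ R, 1 ≤ R ∧ BilayerWallWalkerCoveredFrom R` (`R = 6`, `C_w = 318 + 192R₀`).
WHAT THIS IS NOT: not E1, not StarPairFar (named hypotheses); not the on-reach / deficient / residual parts; F-C1 not moved.
-/

noncomputable section

namespace Summit.Ventures.Crystal3D.Theorems

open scoped InnerProductSpace
open Literature.MathematicalPhysics.StatisticalMechanics (IsHaggSeq triangularVec₁ triangularVec₂ basalMirror haggLabel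
  barlowOffset)
open Summit.Ventures.Crystal3D.Cruxes.TextureLiminf.TexShadow (E3 e₃ cyl stacking BilayerWallAt FluxDominated upSlot₁ upSlot₂
  upSlot₃ upFrame upWord famSlot DeltaSteep BarlowOffReach BarlowCoverable BilayerWallWalkerCovered BilayerWallWalkerCoveredFrom
  upFrame_axis_nonneg isHaggSeq_upWord stacking_upFrame famSlot_steep_of_deltaSteep)

/-- **Selectors of the up-presentation transport to the original presentation, window points and all.**  For a plate
`(L, σ)` and a direction `e`, every step selector `step'` of the up-presentation `(upFrame L e, upWord L σ e)` yields a
step selector `step` of `(L, σ)` itself whose moved polyline-plus-lattice points are THE SAME points: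
`upFrame L e (zigVertexS step' k + t₀u + t₁v) + s = L (zigVertexS step k + t₀u + t₁v) + s` (identity if the frame is
already up; otherwise `step = M ∘ step'` by `isZigSelector_reverse` / `moved_vertex_reverse` of `…BarlowReversal`). -/
theorem selector_of_upFrame (L : E3 ≃ₗᵢ[ℝ] E3) {σ : ℤ → ℤ} (hσ : IsHaggSeq σ) (e s : E3) {step' : ℤ → E3}
    (hsel : IsZigSelector (upFrame L e) (upWord L σ e) e step') :
    ∃ step : ℤ → E3, IsZigSelector L σ e step ∧
      ∀ (k : ℤ) (t : Fin 2 → ℤ),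
        (upFrame L e) (zigVertexS step' k + ((t 0 : ℝ) • triangularVec₁ 1 + (t 1 : ℝ) • triangularVec₂ 1)) + s =
          L (zigVertexS step k + ((t 0 : ℝ) • triangularVec₁ 1 + (t 1 : ℝ) • triangularVec₂ 1)) + s := by
  by_cases h : 0 ≤ (L.symm e) 2
  · have hF : upFrame L e = L := by unfold upFrame; rw [if_pos h]
    have hW : upWord L σ e = σ := by unfold upWord; rw [if_pos h]
    rw [hF, hW] at hsel
    exact ⟨step', hsel, fun k t => by rw [hF]⟩
  · have hneg : (L.symm e) 2 < 0 := lt_of_not_ge h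
    have hF : upFrame L e = basalMirror.trans L := by unfold upFrame; rw [if_neg h]
    have hW : upWord L σ e = fun n => -σ (-n - 1) := by unfold upWord; rw [if_neg h]
    rw [hF, hW] at hsel
    exact ⟨fun k => basalMirror (step' k), isZigSelector_reverse L hσ e hneg hsel, fun k t => by
      rw [hF]; exact moved_vertex_reverse L s step' k t⟩

/-- **CoveredGlue v2 — the walker-covered wall law from ORIENTED line counts.**  If for every thickness `R₀ ≥ R` one rim
constant `C_w` serves every pair of UP-PRESENTED plates (`0 ≤ (L₁⁻¹e₃)₂`, `0 ≤ (L₂⁻¹(−e₃))₂`) whose family slots are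
steep and whose reach sets are off each other and off the other plate — i.e. exactly the hypothesis list and conclusion
shape of lane G's `barlow_hlines_oriented` — then `BilayerWallWalkerCoveredFrom R` (`R ≥ 3`): per pair, Barlow coverability
supplies those hypotheses for the up-presentations (`upFrame_axis_nonneg`, `famSlot_steep_of_deltaSteep`, `BarlowOffReach`,
`stacking_upFrame`), the oriented selectors transport back by `selector_of_upFrame`, and `bilayerWallAt_of_lineCount` (p648386)
turns the line count into the cell inequality with rim constant `(C_w + 80(R₀+9) + 3456 + 1152(R₀+1))/2`.  The frames, the
residual-class exclusion and the axes `m` of `BilayerWallWalkerCovered` are idle: coverability and flux domination drive it. -/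
theorem bilayerWallWalkerCoveredFrom_of_orientedLineCounts (R : ℝ) (hR : 3 ≤ R)
    (hlines : ∀ R₀ : ℝ, R ≤ R₀ → ∃ C_w : ℝ, ∀ (σ₁ σ₂ : ℤ → ℤ), IsHaggSeq σ₁ → IsHaggSeq σ₂ →
      ∀ (L₁ L₂ : E3 ≃ₗᵢ[ℝ] E3) (s₁ s₂ : E3),
      0 ≤ (L₁.symm e₃) 2 → 0 ≤ (L₂.symm (-e₃)) 2 →
      Real.sqrt 2 / 2 ≤ ⟪L₁ (best3 (fun w => ⟪w, L₁.symm e₃⟫_ℝ) upSlot₁ upSlot₂ upSlot₃), e₃⟫_ℝ →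
      Real.sqrt 2 / 2 ≤ ⟪L₂ (best3 (fun w => ⟪w, L₂.symm (-e₃)⟫_ℝ) upSlot₁ upSlot₂ upSlot₃), -e₃⟫_ℝ →
      (∀ y ∈ reachSet L₁ (L₁ ((haggLabel σ₁ 0 : ℝ) • barlowOffset 1) + s₁)
        (chainFrames e₃ L₁ (best3 (fun w => ⟪w, L₁.symm e₃⟫_ℝ) upSlot₁ upSlot₂ upSlot₃)), y ∉ stacking L₂ s₂ σ₂) →
      (∀ y ∈ reachSet L₂ (L₂ ((haggLabel σ₂ 0 : ℝ) • barlowOffset 1) + s₂)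
        (chainFrames (-e₃) L₂ (best3 (fun w => ⟪w, L₂.symm (-e₃)⟫_ℝ) upSlot₁ upSlot₂ upSlot₃)), y ∉ stacking L₁ s₁ σ₁) →
      (∀ y ∈ reachSet L₁ (L₁ ((haggLabel σ₁ 0 : ℝ) • barlowOffset 1) + s₁)
        (chainFrames e₃ L₁ (best3 (fun w => ⟪w, L₁.symm e₃⟫_ℝ) upSlot₁ upSlot₂ upSlot₃)),
        y ∉ reachSet L₂ (L₂ ((haggLabel σ₂ 0 : ℝ) • barlowOffset 1) + s₂)
          (chainFrames (-e₃) L₂ (best3 (fun w => ⟪w, L₂.symm (-e₃)⟫_ℝ) upSlot₁ upSlot₂ upSlot₃))) →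
      ∃ step₁ step₂ : ℤ → E3, IsZigSelector L₁ σ₁ e₃ step₁ ∧ IsZigSelector L₂ σ₂ (-e₃) step₂ ∧
      ∀ h : ℝ, 0 ≤ h → ∀ ρ : ℝ, R₀ ≤ ρ → ∀ X P₁ P₂ : Finset E3,
      (∀ p ∈ X, ∀ q ∈ X, p ≠ q → 1 ≤ dist p q) → P₁ ⊆ X → P₂ ⊆ X \ P₁ → (∀ p ∈ X, p ∈ cyl R₀ h ρ) →
      (∀ p, p ∈ P₁ ↔ (p ∈ stacking L₁ s₁ σ₁ ∧ -(2 * R₀) ≤ p 2 ∧ p 2 ≤ -R₀ ∧ p 0 ^ 2 + p 1 ^ 2 ≤ ρ ^ 2)) →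
      (∀ p, p ∈ P₂ ↔ (p ∈ stacking L₂ s₂ σ₂ ∧ h + R₀ ≤ p 2 ∧ p 2 ≤ h + 2 * R₀ ∧ p 0 ^ 2 + p 1 ^ 2 ≤ ρ ^ 2)) →
      ∃ (m : ℝ) (T₁ T₂ : Finset (Fin 2 → ℤ)), 0 ≤ m ∧
        (∀ t : Fin 2 → ℤ, (∃ k : ℤ,
          -R₀ - 4 ≤ (L₁ (zigVertexS step₁ k + ((t 0 : ℝ) • triangularVec₁ 1 + (t 1 : ℝ) • triangularVec₂ 1)) + s₁) 2 ∧
          (L₁ (zigVertexS step₁ k + ((t 0 : ℝ) • triangularVec₁ 1 + (t 1 : ℝ) • triangularVec₂ 1)) + s₁) 2 ≤ -R₀ - 3 ∧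
          Real.sqrt ((L₁ (zigVertexS step₁ k + ((t 0 : ℝ) • triangularVec₁ 1 + (t 1 : ℝ) • triangularVec₂ 1)) + s₁) 0 ^ 2 +
            (L₁ (zigVertexS step₁ k + ((t 0 : ℝ) • triangularVec₁ 1 + (t 1 : ℝ) • triangularVec₂ 1)) + s₁) 1 ^ 2) ≤ ρ - m) →
          t ∈ T₁) ∧
        (∀ t : Fin 2 → ℤ, (∃ k : ℤ,
          h + R₀ + 3 ≤ (L₂ (zigVertexS step₂ k + ((t 0 : ℝ) • triangularVec₁ 1 + (t 1 : ℝ) • triangularVec₂ 1)) + s₂) 2 ∧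
          (L₂ (zigVertexS step₂ k + ((t 0 : ℝ) • triangularVec₁ 1 + (t 1 : ℝ) • triangularVec₂ 1)) + s₂) 2 ≤ h + R₀ + 4 ∧
          Real.sqrt ((L₂ (zigVertexS step₂ k + ((t 0 : ℝ) • triangularVec₁ 1 + (t 1 : ℝ) • triangularVec₂ 1)) + s₂) 0 ^ 2 +
            (L₂ (zigVertexS step₂ k + ((t 0 : ℝ) • triangularVec₁ 1 + (t 1 : ℝ) • triangularVec₂ 1)) + s₂) 1 ^ 2) ≤ ρ - m) →
          t ∈ T₂) ∧
        (T₁.card : ℝ) + T₂.card + 18 * m * ρ ≤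
          (∑ y ∈ X.filter (fun y => (X.filter fun q => dist y q = 1).card ≠ 12 ∧ -R₀ - 2 ≤ y 2 ∧ y 2 ≤ h + R₀ + 2),
            ((12 : ℝ) - ((X.filter fun q => dist y q = 1).card : ℝ))) + C_w * (1 + h) * ρ) :
    BilayerWallWalkerCoveredFrom R := by
  intro R₀ hR₀
  obtain ⟨C_w, hC⟩ := hlines R₀ hR₀
  refine ⟨(C_w + 80 * (R₀ + 9) + 3456 + 1152 * (R₀ + 1)) / 2, ?_⟩
  intro σ₁ σ₂ hσ₁ hσ₂ L₁ L₂ s₁ s₂ A₁ A₂ u₁ u₂ _hA₁ _hA₂ _hgen hcov c m hadm hflux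
  obtain ⟨hΔ₁, hΔ₂, hO₁, hO₂, hO₃⟩ := hcov
  have hσ₁' : IsHaggSeq (upWord L₁ σ₁ e₃) := isHaggSeq_upWord L₁ hσ₁ e₃
  have hσ₂' : IsHaggSeq (upWord L₂ σ₂ (-e₃)) := isHaggSeq_upWord L₂ hσ₂ (-e₃)
  have hst₁ := famSlot_steep_of_deltaSteep L₁ e₃ hΔ₁
  have hst₂ := famSlot_steep_of_deltaSteep L₂ (-e₃) hΔ₂
  have hO₁' : ∀ y ∈ reachSet (upFrame L₁ e₃) (upFrame L₁ e₃ ((haggLabel (upWord L₁ σ₁ e₃) 0 : ℝ) • barlowOffset 1) + s₁)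
      (chainFrames e₃ (upFrame L₁ e₃) (famSlot L₁ e₃)),
      y ∉ stacking (upFrame L₂ (-e₃)) s₂ (upWord L₂ σ₂ (-e₃)) := fun y hy => by
    rw [stacking_upFrame]; exact hO₁ y hy
  have hO₂' : ∀ y ∈ reachSet (upFrame L₂ (-e₃)) (upFrame L₂ (-e₃) ((haggLabel (upWord L₂ σ₂ (-e₃)) 0 : ℝ) • barlowOffset 1) + s₂)
      (chainFrames (-e₃) (upFrame L₂ (-e₃)) (famSlot L₂ (-e₃))),
      y ∉ stacking (upFrame L₁ e₃) s₁ (upWord L₁ σ₁ e₃) := fun y hy => by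
    rw [stacking_upFrame]; exact hO₂ y hy
  obtain ⟨step₁', step₂', hsel₁', hsel₂', hF4'⟩ :=
    hC _ _ hσ₁' hσ₂' (upFrame L₁ e₃) (upFrame L₂ (-e₃)) s₁ s₂ (upFrame_axis_nonneg L₁ e₃) (upFrame_axis_nonneg L₂ (-e₃))
      hst₁ hst₂ hO₁' hO₂' hO₃
  obtain ⟨step₁, hsel₁, heq₁⟩ := selector_of_upFrame L₁ hσ₁ e₃ s₁ hsel₁'
  obtain ⟨step₂, hsel₂, heq₂⟩ := selector_of_upFrame L₂ hσ₂ (-e₃) s₂ hsel₂'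
  refine bilayerWallAt_of_lineCount hσ₁ hσ₂ L₁ L₂ s₁ s₂ (Real.sqrt 2 / 2) R₀ C_w (le_trans hR hR₀) c hadm.1 hflux
    hsel₁ hsel₂ ?_
  intro h hh ρ hρ X P₁ P₂ hX hP₁X hP₂X hcyl hP₁ hP₂
  have hP₁' : ∀ p, p ∈ P₁ ↔ (p ∈ stacking (upFrame L₁ e₃) s₁ (upWord L₁ σ₁ e₃) ∧ -(2 * R₀) ≤ p 2 ∧ p 2 ≤ -R₀ ∧
      p 0 ^ 2 + p 1 ^ 2 ≤ ρ ^ 2) := fun p => by rw [stacking_upFrame]; exact hP₁ p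
  have hP₂' : ∀ p, p ∈ P₂ ↔ (p ∈ stacking (upFrame L₂ (-e₃)) s₂ (upWord L₂ σ₂ (-e₃)) ∧ h + R₀ ≤ p 2 ∧ p 2 ≤ h + 2 * R₀ ∧
      p 0 ^ 2 + p 1 ^ 2 ≤ ρ ^ 2) := fun p => by rw [stacking_upFrame]; exact hP₂ p
  obtain ⟨m', T₁, T₂, hm', hT₁, hT₂, hcount⟩ := hF4' h hh ρ hρ X P₁ P₂ hX hP₁X hP₂X hcyl hP₁' hP₂'
  refine ⟨m', T₁, T₂, hm', ?_, ?_, hcount⟩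
  · rintro t ⟨k, hk⟩
    refine hT₁ t ⟨k, ?_⟩
    rw [heq₁ k t]
    exact hk
  · rintro t ⟨k, hk⟩
    refine hT₂ t ⟨k, ?_⟩
    rw [heq₂ k t]
    exact hk

/-- **THE WALKER-COVERED WALL STUB, BY NAME, MODULO E1 AND StarPairFar** (`stub_bilayerWallWalkerCovered` of TexShadow
v6.9/v6.10): lane G's E1 input in certified normal form (`sE ∈ fccSlots`, `ExactOnly 0 {w ∈ fccSlots | 0 < ⟪w, sE⟫}` =
`P5Exhaustion`'s kernel) and the stars-only double-end inputs (`DoubleStarCoaxialAt` for all frame pairs, `CapPairCoaxial` —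
both consequences of the certified `StarPairFar`, `…GenericWallFloorStarPairCoaxial`) imply
`∃ R, 1 ≤ R ∧ BilayerWallWalkerCoveredFrom R` (`R = 6`; rim constant
`((318 + 192R₀) + 80(R₀+9) + 3456 + 1152(R₀+1))/2`): `bilayerWallWalkerCoveredFrom_of_orientedLineCounts` fed with lane G's
F4 `barlow_hlines_oriented` (19480-p2 p653507). -/
theorem bilayerWallWalkerCovered_of_F4 {sE : E3} (hsE : sE ∈ fccSlots)
    (hcert : ExactOnly 0 (fccSlots.filter fun w => 0 < ⟪w, sE⟫_ℝ))
    (hDS : ∀ F₁ F₂ : E3 ≃ₗᵢ[ℝ] E3, DoubleStarCoaxialAt F₁ F₂) (hCP : CapPairCoaxial) :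
    ∃ R : ℝ, 1 ≤ R ∧ BilayerWallWalkerCoveredFrom R := by
  refine ⟨6, by norm_num, bilayerWallWalkerCoveredFrom_of_orientedLineCounts 6 (by norm_num) ?_⟩
  intro R₀ hR₀
  exact ⟨318 + 192 * R₀, fun σ₁ σ₂ hσ₁ hσ₂ L₁ L₂ s₁ s₂ hax₁ hax₂ hst₁ hst₂ hO₁ hO₂ hO₃ =>
    barlow_hlines_oriented hsE hcert hDS hCP hσ₁ hσ₂ L₁ L₂ s₁ s₂ hax₁ hax₂ hst₁ hst₂ hO₁ hO₂ hO₃ R₀ hR₀⟩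

end Summit.Ventures.Crystal3D.Theorems

end
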